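import Literature.MathematicalPhysics.QuantumFieldTheory.Balaban1983to89.B9Eq326OperatorAssembly
import Literature.MathematicalPhysics.QuantumFieldTheory.Balaban1983to89.B9Eq310HessianHermitian

/-!
# `Balaban1983to89.B9Eq326OperatorSymmetric` — T. Bałaban, *Propagators for lattice gauge theories in a background field*, Commun. Math. Phys. **99**
# (1985) 389–434 [Balaban1985BackgroundPropagators] (3.26) p. 395 with (3.10) p. 392 and [Balaban1985Variational] p. 293: THE ASSEMBLED OPERATOR
# `Δ_a(U) = Δ(U) + D R(U) D* + Q*aQ` IS SYMMETRIC for a unitary background and a `*`-trace — the «scalar product defined by the operator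
# Δ₁ + D*RD + aQ*Q» of [B11] p. 293 is a genuine symmetric form at the CONSTRUCTED letters

statement-level skeleton of published theorems with citation tags; proofs where landed; nothing here is a claim
about the Yang–Mills mass gap

PDF held: `paper:balaban1985-cmp99-background-propagators`, `paper:balaban1985-cmp102-variational-background`; the verbatim texts are quoted in
`B9Eq326OperatorAssembly`, `B9Eq310HessianHermitian`, `B11Eq103H1Complex`.

THE PRINT.  [B9] p. 392: *«For U with values in the unitary group U(N) it is a hermitian operator»*; [B11] p. 293: *«the scalar product defined by the
operator Δ₁ + D*RD + aQ*Q»*; [B9] (3.26) p. 395: *«Δ_a(U) = Δ(U) + D_U R(U) D*_U + Q*(U)aQ(U)»*.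

WHY THIS FILE (cell context).  The symmetry letters of `B11Eq103H1Complex.laplaceALatticeK_isSymmetric` (`hc`, `hRS`, `hΔ`, `hR`) DISCHARGED at the
assembled operator `B9Eq326OperatorAssembly.laplaceAofU`: `hc` (the scalar `η⁻¹` is real), `hRS` (`B9Eq310HessianHermitian.adTransportW_adjoint`),
`hΔ` (`hessOp_isSymmetric_of_trace`), `hR` (`RofU_isSymmetric`) — so `Δ_a(U)` is a SYMMETRIC operator from three structural model facts only
(unitary `U`, `*`-trace `τ`, compatibility of the two normings).

WHAT IS PROVED (sorry-free).  **`laplaceAofU_isSymmetric`**.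
MODEL / HONEST SCOPE.  As the imported files; no estimate (positivity = [B9] Thm 3.11 stays displayed); NOT summit progress (cell pub-balaban: NE9 NOT
PRINTED / NOT PROVED; spine PROVED 0/9).  Filed by the pub-balaban NE9 BINDER-row owner lineage `b2b-balaban-t4-ne9-p1` (gen 77); NEW file; nothing
modified.  Net new unproved facts: 0.
-/

noncomputable section

open scoped InnerProductSpace ComplexConjugate BigOperators

namespace Literature.MathematicalPhysics.QuantumFieldTheory.Balaban1983to89.B9Eq326OperatorSymmetric

open B4Sect5Torus (TSite)
open B9SectCLatticeCarrier (Bond)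
open B9Eq311L2Pairing (WL2)
open B11Eq103H1Complex (BondL2K laplaceALatticeK_isSymmetric)
open B9Eq310HessianOperator (adTransportW hessOp)
open B9Eq310HessianHermitian (adTransportW_adjoint hessOp_isSymmetric_of_trace)
open B9Eq319QprimeTorus (fineP)
open B9Eq326OperatorAssembly (laplaceAofU RofU_isSymmetric)

variable {d : ℕ} (L : ℕ) [NeZero L] (m : Fin d → ℕ) {𝔸 : Type*} [Ring 𝔸] [StarRing 𝔸] [Algebra ℂ 𝔸] [StarModule ℂ 𝔸]
  {W : Type*} [NormedAddCommGroup W] [InnerProductSpace ℂ W] [FiniteDimensional ℂ W] (φ : W ≃ₗ[ℂ] 𝔸) {c₀ : ℝ} [Fact (0 < c₀)]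
  (τ : 𝔸 →ₗ[ℂ] ℂ) (η : ℝ) {U : Bond d (fineP L m) → 𝔸ˣ} {F : Type*} [NormedAddCommGroup F] [InnerProductSpace ℂ F] [FiniteDimensional ℂ F]

/-- **`Δ_a(U) = Δ(U) + D R(U) D* + Q*aQ` IS A SYMMETRIC OPERATOR** on the `L²` space of `𝔤ᶜ`-valued bond functions of the torus, for a unitary
background (`U(b)* = U(b)⁻¹`), a `*`-trace `τ` (`τ(X*) = conj τ(X)`, `τ(XY) = τ(YX)`) and the compatibility `⟨φ⁻¹X, φ⁻¹Y⟩ = τ(X*Y)` of the two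
normings — every symmetry letter of `laplaceALatticeK_isSymmetric` DISCHARGED at the assembled letters. [cite: Balaban1985BackgroundPropagators, (3.26) p.395, (3.10) p.392; Balaban1985Variational, p.293] -/
theorem laplaceAofU_isSymmetric (hU : ∀ b, star (U b : 𝔸) = ((U b)⁻¹ : 𝔸ˣ)) (hτ₁ : ∀ X : 𝔸, τ (star X) = conj (τ X))
    (hτ₂ : ∀ X Y : 𝔸, τ (X * Y) = τ (Y * X)) (hφ : ∀ X Y : 𝔸, ⟪φ.symm X, φ.symm Y⟫_ℂ = τ (star X * Y))
    (Q : BondL2K ℂ d (fineP L m) c₀ W →ₗ[ℂ] F) (a : ℝ) : (laplaceAofU L m φ η U τ Q a).IsSymmetric :=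
  laplaceALatticeK_isSymmetric (by rw [map_inv₀, Complex.conj_ofReal]) (adTransportW_adjoint φ τ hτ₂ hU hφ)
    (hessOp_isSymmetric_of_trace φ τ hτ₁ hτ₂ η hU hφ) (RofU_isSymmetric L m φ η U)

end Literature.MathematicalPhysics.QuantumFieldTheory.Balaban1983to89.B9Eq326OperatorSymmetric

end
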